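import Literature.Geometry.Lorentzian.ConstraintFamilies
import Literature.Geometry.Lorentzian.ConformalChange
import Literature.Geometry.Manifold.OpenSubmanifoldMFDeriv
import HarnessLib

/-!
# The constraint functions are local; the mean curvature of any initial data set is smooth

Two pieces of bookkeeping for patching constructions with initial data sets on a `3`-manifold
`X` (modelled on `E3`), both immediate from the diffeomorphism-equivariance of the constraint map
(`InitialDataPullback.lean`, Bartnik–Isenberg 2004, §2) applied to OPEN INCLUSIONS:

* `InitialDataSet.contMDiff_traceK` — **`tr_h k` is smooth on `X`** for every initial data set
  (read `D` through the inverse of a chart, an equidimensional immersion from an open subset of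
  `E3`, where `OpensChart.contMDiff_traceK` applies and `tr` is natural, `traceK_comap`); this is
  the differentiability hypothesis `htr` of `momentumConstraintFn_comap_apply`, now discharged once
  and for all (`mdifferentiableAt_traceK`);
* `InitialDataSet.hamiltonianConstraintFn_congr`, `momentumConstraintFn_congr`,
  `isVacuumAt_congr` — **the constraint functions at `x` depend only on the germ of `(h, k)` at
  `x`**: if two data sets have the same sections on a neighbourhood of `x` then their Hamiltonian
  constraint functions and momentum constraint covectors at `x` agree (pull both back along the
  inclusion of an open set on which they agree: the pulled-back data coincide, and the constraint
  map is natural under the inclusion, whose differential is the identity,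
  `OpenSubmanifold.mfderiv_subtype_val`). Bartnik–Isenberg 2004, §2 ("local character of the
  constraints").

Everything is proved; no definitions, no named facts.

## References

* R. Bartnik, J. Isenberg, *The constraint equations* (2004), §2. [BartnikIsenberg2004]
* B. O'Neill, *Semi-Riemannian geometry* (1983), Ch. 3, Prop. 3.59. [ONeill1983]
-/

noncomputable section

open Bundle Set Function Filter Manifold TopologicalSpace
open scoped Manifold ContDiff Topology

namespace Literature.Geometry.Lorentzian

namespace InitialDataSet

variable {X : Type*} [TopologicalSpace X] [ChartedSpace E3 X] [IsManifold (𝓡 3) ∞ X]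

/-! ### Smoothness of the mean curvature -/

/-- **The mean curvature `tr_h k` of an initial data set on a `3`-manifold is smooth.** Near `x`,
read `D` through the inverse chart `Φ = (chartAt E3 x).symm` on the chart target `U ⊆ E3` (an
equidimensional immersion): `tr(Φ^*k) = (tr k) ∘ Φ` (`traceK_comap_eq`) is smooth on `U`
(`OpensChart.contMDiff_traceK`), and `tr k = tr(Φ^*k) ∘ chart` near `x`. [cite: BartnikIsenberg2004, §2] -/
theorem contMDiff_traceK (D : InitialDataSet (𝓡 3) X) : ContMDiff (𝓡 3) 𝓘(ℝ, ℝ) ∞ D.traceK := by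
  intro x
  set c := chartAt E3 x with hc
  set U : Opens E3 := ⟨c.target, c.open_target⟩ with hU
  set Φ : U → X := fun u ↦ c.symm u with hΦ
  have hΦs : ContMDiff 𝓘(ℝ, E3) (𝓡 3) (∞ + 1) Φ := ChartInverse.contMDiff_symm x
  have hΦ' : ∀ u, Injective (mfderiv 𝓘(ℝ, E3) (𝓡 3) Φ u) := ChartInverse.injective_mfderiv_symm x
  set D' : InitialDataSet 𝓘(ℝ, E3) U := D.comap Φ hΦs hΦ' with hD'
  have htr' : ContMDiff 𝓘(ℝ, E3) 𝓘(ℝ, ℝ) ∞ D'.traceK := OpensChart.contMDiff_traceK D'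
  have heq : D'.traceK = D.traceK ∘ Φ := D.traceK_comap_eq hΦs hΦ' rfl
  -- the chart as a map into `U`, near `x`
  have hxs : x ∈ c.source := mem_chart_source E3 x
  have hcx : c x ∈ c.target := c.map_source hxs
  -- smoothness of `tr k ∘ Φ ∘ (inclusion)` read as a function on `E3` at `c x`
  have h1 : ContMDiffAt 𝓘(ℝ, E3) 𝓘(ℝ, ℝ) ∞ (fun z : E3 ↦ D.traceK (c.symm z)) (c x) := by
    have h2 : ContMDiff 𝓘(ℝ, E3) 𝓘(ℝ, ℝ) ∞ (fun u : U ↦ D.traceK (c.symm u)) := by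
      have : (fun u : U ↦ D.traceK (c.symm u)) = D'.traceK := by
        rw [heq]
        rfl
      rw [this]
      exact htr'
    exact (contMDiffAt_subtype_iff (U := U) (f := fun z : E3 ↦ D.traceK (c.symm z))
      (x := ⟨c x, hcx⟩)).1 (h2 ⟨c x, hcx⟩)
  have hchart : ContMDiffAt (𝓡 3) 𝓘(ℝ, E3) ∞ c x :=
    (contMDiffOn_chart (I := 𝓡 3) (x := x) (n := ∞)).contMDiffAt (c.open_source.mem_nhds hxs)
  have hcomp : ContMDiffAt (𝓡 3) 𝓘(ℝ, ℝ) ∞ ((fun z : E3 ↦ D.traceK (c.symm z)) ∘ c) x :=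
    h1.comp x hchart
  refine hcomp.congr_of_eventuallyEq ?_
  filter_upwards [c.open_source.mem_nhds hxs] with y hy
  simp only [Function.comp_apply, c.left_inv hy]

/-- The mean curvature of an initial data set on a `3`-manifold is differentiable everywhere (the
hypothesis `htr` of `momentumConstraintFn_comap_apply`). [cite: BartnikIsenberg2004, §2] -/
theorem mdifferentiableAt_traceK (D : InitialDataSet (𝓡 3) X) (x : X) :
    MDifferentiableAt (𝓡 3) 𝓘(ℝ, ℝ) D.traceK x :=
  (D.contMDiff_traceK x).mdifferentiableAt (by simp)

/-! ### Locality of the constraint functions -/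

section Locality

variable {D D' : InitialDataSet (𝓡 3) X} {x : X}

omit [IsManifold (𝓡 3) ∞ X] in
/-- The inclusion of an open submanifold is `C^∞` in the degree `∞ + 1` required by pullbacks of
data. [folklore] -/
theorem contMDiff_subtypeVal_succ (V : Opens X) :
    ContMDiff (𝓡 3) (𝓡 3) (∞ + 1) (Subtype.val : V → X) := contMDiff_subtype_val

omit [IsManifold (𝓡 3) ∞ X] in
/-- The differentials of the inclusion of an open submanifold are injective (they are the
identity, `OpenSubmanifold.mfderiv_subtype_val`). [folklore] -/
theorem injective_mfderiv_subtypeVal (V : Opens X) (u : V) :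
    Injective (mfderiv (𝓡 3) (𝓡 3) (Subtype.val : V → X) u) := by
  rw [Literature.Geometry.Manifold.OpenSubmanifold.mfderiv_subtype_val]
  exact fun v w h ↦ h

/-- Two data sets with the same sections on an open set `V` have the same pullback to `V`.
[cite: BartnikIsenberg2004, §2] -/
theorem comap_subtypeVal_eq_of_eqOn (V : Opens X)
    (hh : ∀ y ∈ (V : Set X), D.h.inner y = D'.h.inner y) (hk : ∀ y ∈ (V : Set X), D.k y = D'.k y) :
    D.comap (Subtype.val : V → X) (contMDiff_subtypeVal_succ V) (injective_mfderiv_subtypeVal V) =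
      D'.comap (Subtype.val : V → X) (contMDiff_subtypeVal_succ V) (injective_mfderiv_subtypeVal V) := by
  refine ext' (fun u v w ↦ ?_) (fun u v w ↦ ?_)
  · rw [comap_h_inner, comap_h_inner, hh u u.2]
  · rw [comap_k, comap_k, hk u u.2]

/-- **Locality of the Hamiltonian constraint function**: if `(h, k)` and `(h', k')` have the same
sections on a neighbourhood of `x`, then `(R − |k|² + (tr k)²)(x)` is the same for both.
Bartnik–Isenberg 2004, §2 (local character of the constraints), via naturality under the
inclusion of an open set on which the data agree (`hamiltonianConstraintFn_comap`).
[cite: BartnikIsenberg2004, §2] -/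
theorem hamiltonianConstraintFn_congr [D.metric.HasLeviCivita] [D'.metric.HasLeviCivita]
    (hh : ∀ᶠ y in 𝓝 x, D.h.inner y = D'.h.inner y) (hk : ∀ᶠ y in 𝓝 x, D.k y = D'.k y) :
    D.hamiltonianConstraintFn x = D'.hamiltonianConstraintFn x := by
  obtain ⟨W, hW, hWo, hxW⟩ := mem_nhds_iff.1 (hh.and hk)
  set V : Opens X := ⟨W, hWo⟩ with hV
  have hcomap := comap_subtypeVal_eq_of_eqOn (D := D) (D' := D') V (fun y hy ↦ (hW hy).1)
    (fun y hy ↦ (hW hy).2)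
  haveI h1 : (D.comap (Subtype.val : V → X) (contMDiff_subtypeVal_succ V)
      (injective_mfderiv_subtypeVal V)).metric.HasLeviCivita := PseudoRiemannianMetric.hasLeviCivita _
  haveI h2 : (D'.comap (Subtype.val : V → X) (contMDiff_subtypeVal_succ V)
      (injective_mfderiv_subtypeVal V)).metric.HasLeviCivita := PseudoRiemannianMetric.hasLeviCivita _
  have e1 : (D.comap (Subtype.val : V → X) (contMDiff_subtypeVal_succ V)
      (injective_mfderiv_subtypeVal V)).hamiltonianConstraintFn ⟨x, hxW⟩ = D.hamiltonianConstraintFn x :=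
    D.hamiltonianConstraintFn_comap (contMDiff_subtypeVal_succ V) (injective_mfderiv_subtypeVal V) rfl ⟨x, hxW⟩
  have e2 : (D'.comap (Subtype.val : V → X) (contMDiff_subtypeVal_succ V)
      (injective_mfderiv_subtypeVal V)).hamiltonianConstraintFn ⟨x, hxW⟩ = D'.hamiltonianConstraintFn x :=
    D'.hamiltonianConstraintFn_comap (contMDiff_subtypeVal_succ V) (injective_mfderiv_subtypeVal V) rfl ⟨x, hxW⟩
  have key : ∀ (A B : InitialDataSet (𝓡 3) V) [A.metric.HasLeviCivita] [B.metric.HasLeviCivita],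
      A = B → A.hamiltonianConstraintFn ⟨x, hxW⟩ = B.hamiltonianConstraintFn ⟨x, hxW⟩ := by
    intro A B _ _ hAB
    subst hAB
    rfl
  rw [← e1, ← e2]
  exact key _ _ hcomap

/-- **Locality of the momentum constraint covector**: if `(h, k)` and `(h', k')` have the same
sections on a neighbourhood of `x`, then `(div k − d tr k)(x)` is the same for both.
Bartnik–Isenberg 2004, §2, via `momentumConstraintFn_comap_apply` under the inclusion of an open
set on which the data agree (its differential is the identity) and `mdifferentiableAt_traceK`.
[cite: BartnikIsenberg2004, §2] -/
theorem momentumConstraintFn_congr [D.metric.HasLeviCivita] [D'.metric.HasLeviCivita]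
    (hh : ∀ᶠ y in 𝓝 x, D.h.inner y = D'.h.inner y) (hk : ∀ᶠ y in 𝓝 x, D.k y = D'.k y) :
    D.momentumConstraintFn x = D'.momentumConstraintFn x := by
  obtain ⟨W, hW, hWo, hxW⟩ := mem_nhds_iff.1 (hh.and hk)
  set V : Opens X := ⟨W, hWo⟩ with hV
  have hcomap := comap_subtypeVal_eq_of_eqOn (D := D) (D' := D') V (fun y hy ↦ (hW hy).1)
    (fun y hy ↦ (hW hy).2)
  haveI h1 : (D.comap (Subtype.val : V → X) (contMDiff_subtypeVal_succ V)
      (injective_mfderiv_subtypeVal V)).metric.HasLeviCivita := PseudoRiemannianMetric.hasLeviCivita _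
  haveI h2 : (D'.comap (Subtype.val : V → X) (contMDiff_subtypeVal_succ V)
      (injective_mfderiv_subtypeVal V)).metric.HasLeviCivita := PseudoRiemannianMetric.hasLeviCivita _
  have key : ∀ (A B : InitialDataSet (𝓡 3) V) [A.metric.HasLeviCivita] [B.metric.HasLeviCivita],
      A = B → A.momentumConstraintFn ⟨x, hxW⟩ = B.momentumConstraintFn ⟨x, hxW⟩ := by
    intro A B _ _ hAB
    subst hAB
    rfl
  have hAB := key _ _ hcomap
  refine LinearMap.ext fun v ↦ ?_
  have e1 : (D.comap (Subtype.val : V → X) (contMDiff_subtypeVal_succ V)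
      (injective_mfderiv_subtypeVal V)).momentumConstraintFn ⟨x, hxW⟩ v = D.momentumConstraintFn x v := by
    have h := D.momentumConstraintFn_comap_apply (contMDiff_subtypeVal_succ V)
      (injective_mfderiv_subtypeVal V) rfl ⟨x, hxW⟩ (D.mdifferentiableAt_traceK x) v
    rw [Literature.Geometry.Manifold.OpenSubmanifold.mfderiv_subtype_val] at h
    exact h
  have e2 : (D'.comap (Subtype.val : V → X) (contMDiff_subtypeVal_succ V)
      (injective_mfderiv_subtypeVal V)).momentumConstraintFn ⟨x, hxW⟩ v = D'.momentumConstraintFn x v := by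
    have h := D'.momentumConstraintFn_comap_apply (contMDiff_subtypeVal_succ V)
      (injective_mfderiv_subtypeVal V) rfl ⟨x, hxW⟩ (D'.mdifferentiableAt_traceK x) v
    rw [Literature.Geometry.Manifold.OpenSubmanifold.mfderiv_subtype_val] at h
    exact h
  rw [← e1, ← e2]
  exact LinearMap.congr_fun hAB v

/-- **Locality of the vacuum constraints at a point**: data agreeing near `x` satisfy the vacuum
constraint equations at `x` simultaneously. [cite: BartnikIsenberg2004, §2] -/
theorem isVacuumAt_congr [D.metric.HasLeviCivita] [D'.metric.HasLeviCivita]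
    (hh : ∀ᶠ y in 𝓝 x, D.h.inner y = D'.h.inner y) (hk : ∀ᶠ y in 𝓝 x, D.k y = D'.k y) :
    (D.hamiltonianConstraintFn x = 0 ∧ D.momentumConstraintFn x = 0) ↔
      (D'.hamiltonianConstraintFn x = 0 ∧ D'.momentumConstraintFn x = 0) := by
  rw [hamiltonianConstraintFn_congr hh hk, momentumConstraintFn_congr hh hk]

/-- **Pullbacks of vacuum data along arbitrary local diffeomorphisms are vacuum** — the version
of `isVacuumConstraintSolution_comap` with its differentiability hypothesis on `tr k` discharged
by `mdifferentiableAt_traceK` (target a `3`-manifold). [cite: BartnikIsenberg2004, §2] -/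
theorem isVacuumConstraintSolution_comap' {N : Type*} [TopologicalSpace N] [ChartedSpace E3 N]
    [IsManifold (𝓡 3) ∞ N] (D : InitialDataSet (𝓡 3) X) {Φ : N → X}
    (hΦ : ContMDiff (𝓡 3) (𝓡 3) (∞ + 1) Φ) (hΦ' : ∀ u, Injective (mfderiv (𝓡 3) (𝓡 3) Φ u))
    [D.metric.HasLeviCivita] [(D.comap Φ hΦ hΦ').metric.HasLeviCivita]
    (hD : D.IsVacuumConstraintSolution) : (D.comap Φ hΦ hΦ').IsVacuumConstraintSolution :=
  D.isVacuumConstraintSolution_comap hΦ hΦ' rfl hD (D.mdifferentiableAt_traceK)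

/-- Pointwise form of the naturality of the vacuum constraints: for a local diffeomorphism
`Φ : N → X` into a `3`-manifold, `Φ^* D` satisfies the vacuum constraints at `u` iff `D` does at
`Φ u`. [cite: BartnikIsenberg2004, §2] -/
theorem isVacuumAt_comap_iff {N : Type*} [TopologicalSpace N] [ChartedSpace E3 N]
    [IsManifold (𝓡 3) ∞ N] (D : InitialDataSet (𝓡 3) X) {Φ : N → X}
    (hΦ : ContMDiff (𝓡 3) (𝓡 3) (∞ + 1) Φ) (hΦ' : ∀ u, Injective (mfderiv (𝓡 3) (𝓡 3) Φ u))
    [D.metric.HasLeviCivita] [(D.comap Φ hΦ hΦ').metric.HasLeviCivita] (u : N) :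
    ((D.comap Φ hΦ hΦ').hamiltonianConstraintFn u = 0 ∧ (D.comap Φ hΦ hΦ').momentumConstraintFn u = 0) ↔
      (D.hamiltonianConstraintFn (Φ u) = 0 ∧ D.momentumConstraintFn (Φ u) = 0) := by
  have hinv : (mfderiv (𝓡 3) (𝓡 3) Φ u).IsInvertible :=
    PseudoRiemannianMetric.isInvertible_mfderiv_of_injective rfl (hΦ' u)
  rw [D.hamiltonianConstraintFn_comap hΦ hΦ' rfl u]
  refine and_congr Iff.rfl ⟨fun h ↦ ?_, fun h ↦ ?_⟩
  · refine LinearMap.ext fun w ↦ ?_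
    obtain ⟨v, rfl⟩ := hinv.surjective w
    have := LinearMap.congr_fun h v
    rw [D.momentumConstraintFn_comap_apply hΦ hΦ' rfl u (D.mdifferentiableAt_traceK _) v] at this
    exact this
  · refine LinearMap.ext fun v ↦ ?_
    rw [D.momentumConstraintFn_comap_apply hΦ hΦ' rfl u (D.mdifferentiableAt_traceK _) v, h]
    rfl

end Locality

end InitialDataSet

end Literature.Geometry.Lorentzian

end
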